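import Literature.Analysis.FluidPDE.TorusWordChainRule
import Literature.Analysis.FluidPDE.TorusWordL2Bounds
import Literature.Analysis.FluidPDE.TorusWordEnergy
import HarnessLib

/-!
# `L²` product and chain rules along words, with sup norms of the low-order factors only

Analysis/FluidPDE support file (everything proved; no named facts), sequel of `TorusWordChainRule`,
`TorusWordL2Bounds`, `TorusWordEnergy`. The Moser-type calculus inequalities behind the energy
method at arbitrary order (Majda 1984, Ch. 2 §2.1, Prop. 2.1–2.2) are proved here in the crude
"one factor in `L²`, the others in `L^∞`" form which suffices for the propagation of regularity
(the continuation principle, Majda 1984, Thm 2.2) at all orders `s ≥ 6`: in the Leibniz /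
chain-rule expansions of `∂^w(fg)` and `∂^w(φ ∘ ρ)` the factor of LOWER order is put in the sup
norm, so that sup bounds are only needed up to HALF the order:

* `integral_sq_wordDeriv_mul_le` — if `|∂^v f|, |∂^v g| ≤ C` for `2|v| ≤ n` then for `|w| ≤ n`
  `∫ (∂^w(fg))² ≤ 4^{|w|} C² (sobolevEnergy n f + sobolevEnergy n g)`;
* `exists_wordDeriv_comp_L2_bound` — for every `n, Cφ, Cρ` there is `K` with: for all smooth `φ`
  (`|φ^{(k)}| ≤ Cφ` on the range, `k ≤ n`) and smooth `ρ` with `|∂^v ρ| ≤ Cρ` for `1 ≤ |v|`,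
  `2|v| ≤ n`: `∫ (∂^w(φ ∘ ρ))² ≤ K · sobolevEnergy n ρ` for `1 ≤ |w| ≤ n` (induction on `n`, the
  composite factor `∂^α(φ' ∘ ρ)` being taken in `L²` exactly when `|α| ≥ |β| + 2`).

## References

* A. Majda, *Compressible Fluid Flow and Systems of Conservation Laws in Several Space
  Variables*, Springer 1984, Ch. 2 §2.1, Prop. 2.1–2.2 and proof of Thm 2.2. [`Majda1984`]
-/

noncomputable section

open Set Function MeasureTheory
open scoped ContDiff

namespace Literature.Analysis.FluidPDE

namespace Torus

open FunctionSpaces FunctionSpaces.Torus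

variable {d : Type*} [Fintype d] [DecidableEq d]

/-! ## Single words against the Sobolev energy (real-valued) -/

/-- `∫ (∂^v ρ)² ≤ sobolevEnergy n ρ` for `|v| ≤ n` (real-valued fields). [folklore] -/
theorem integral_sq_wordDeriv_le_sobolevEnergy (ρ : UnitAddTorus d → ℝ) {n : ℕ} {v : List d} (hv : v.length ≤ n) :
    ∫ x, wordDeriv v ρ x ^ 2 ≤ sobolevEnergy n ρ := by
  have h1 := integral_norm_sq_wordDeriv_le_wordEnergy (fun i => v.get i) ρ
  rw [List.ofFn_get] at h1
  simp only [Real.norm_eq_abs, sq_abs] at h1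
  exact h1.trans (wordEnergy_le_sobolevEnergy hv ρ)

omit [DecidableEq d] in
/-- Continuous functions on the torus are integrable (real-valued shortcut). [folklore] -/
theorem integrable_of_continuous_real {g : UnitAddTorus d → ℝ} (hg : Continuous g) : Integrable g volume :=
  hg.integrable_of_hasCompactSupport (HasCompactSupport.of_compactSpace _)

omit [DecidableEq d] in
/-- `∫ (φ ψ)² ≤ A² ∫ ψ²` when `|φ| ≤ A`. [folklore] -/
theorem integral_sq_mul_le_sup_left {φ ψ : UnitAddTorus d → ℝ} (hφ : Continuous φ) (hψ : Continuous ψ) {A : ℝ}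
    (hA : ∀ x, |φ x| ≤ A) : ∫ x, (φ x * ψ x) ^ 2 ≤ A ^ 2 * ∫ x, ψ x ^ 2 := by
  have h := integral_norm_sq_smul_le_left (F := ℝ) hφ hψ hA
  simpa only [smul_eq_mul, Real.norm_eq_abs, sq_abs] using h

omit [DecidableEq d] in
/-- `∫ (φ ψ)² ≤ B² ∫ φ²` when `|ψ| ≤ B`. [folklore] -/
theorem integral_sq_mul_le_sup_right {φ ψ : UnitAddTorus d → ℝ} (hφ : Continuous φ) (hψ : Continuous ψ) {B : ℝ}
    (hB : ∀ x, |ψ x| ≤ B) : ∫ x, (φ x * ψ x) ^ 2 ≤ B ^ 2 * ∫ x, φ x ^ 2 := by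
  have h := integral_norm_sq_smul_le_right (F := ℝ) hφ hψ (fun x => by rw [Real.norm_eq_abs]; exact hB x)
  simpa only [smul_eq_mul, Real.norm_eq_abs, sq_abs] using h

omit [DecidableEq d] in
/-- `∫ (∑_{p ∈ l} g_p)² ≤ |l| ∑ₖ ∫ (g_{l[k]})²` (real-valued list version). [folklore] -/
theorem integral_sq_list_sum_le {ι : Type*} (l : List ι) {g : ι → UnitAddTorus d → ℝ} (hg : ∀ p ∈ l, Continuous (g p)) :
    ∫ x, (l.map g).sum x ^ 2 ≤ l.length * ∑ k : Fin l.length, ∫ x, g (l.get k) x ^ 2 := by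
  have h := integral_norm_sq_list_sum_le (F := ℝ) l hg
  simpa only [Real.norm_eq_abs, sq_abs] using h

/-! ## The `L²` product rule along words -/

/-- **`L²` product rule along words**: if `|∂^v f| ≤ C` and `|∂^v g| ≤ C` for all words with
`2|v| ≤ n`, then `∫ (∂^w(fg))² ≤ 4^{|w|} C² (sobolevEnergy n f + sobolevEnergy n g)` for `|w| ≤ n`.
[cite: Majda1984, Ch. 2 §2.1 Prop. 2.1] -/
theorem integral_sq_wordDeriv_mul_le {f g : UnitAddTorus d → ℝ} (hf : IsSmooth f) (hg : IsSmooth g) {n : ℕ} {C : ℝ}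
    (hCf : ∀ v : List d, 2 * v.length ≤ n → ∀ x, |wordDeriv v f x| ≤ C)
    (hCg : ∀ v : List d, 2 * v.length ≤ n → ∀ x, |wordDeriv v g x| ≤ C)
    {w : List d} (hw : w.length ≤ n) :
    ∫ x, wordDeriv w (fun y => f y * g y) x ^ 2 ≤ 4 ^ w.length * (C ^ 2 * (sobolevEnergy n f + sobolevEnergy n g)) := by
  rw [wordDeriv_mul hf hg w]
  have hcont : ∀ p ∈ splits w, Continuous (fun y => wordDeriv p.1 f y * wordDeriv p.2 g y) := fun p _ => by
    have hm : IsSmooth (fun y => wordDeriv p.1 f y * wordDeriv p.2 g y) :=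
      (isSmooth_wordDeriv hf p.1).mul (isSmooth_wordDeriv hg p.2)
    exact hm.continuous
  refine (integral_sq_list_sum_le (splits w) hcont).trans ?_
  -- each term: the lower-order factor in the sup norm
  have hterm : ∀ k : Fin (splits w).length, ∫ x, (fun y => wordDeriv ((splits w).get k).1 f y *
      wordDeriv ((splits w).get k).2 g y) x ^ 2 ≤ C ^ 2 * (sobolevEnergy n f + sobolevEnergy n g) := by
    intro k
    set p := (splits w).get k with hp
    have hpm : p ∈ splits w := List.get_mem _ k
    have hl := mem_splits_length hpm
    have hEf := sobolevEnergy_nonneg n f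
    have hEg := sobolevEnergy_nonneg n g
    by_cases hc : p.1.length ≤ p.2.length
    · -- `∂^{p.1} f` in sup
      have h2 : 2 * p.1.length ≤ n := by omega
      have h := integral_sq_mul_le_sup_left (isSmooth_wordDeriv hf p.1).continuous (isSmooth_wordDeriv hg p.2).continuous
        (hCf p.1 h2)
      have h' := integral_sq_wordDeriv_le_sobolevEnergy g (n := n) (v := p.2) (by omega)
      have hC2 : 0 ≤ C ^ 2 := sq_nonneg C
      calc _ ≤ C ^ 2 * ∫ x, wordDeriv p.2 g x ^ 2 := h
        _ ≤ C ^ 2 * (sobolevEnergy n f + sobolevEnergy n g) := by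
            exact mul_le_mul_of_nonneg_left (by linarith) hC2
    · have h2 : 2 * p.2.length ≤ n := by omega
      have h := integral_sq_mul_le_sup_right (isSmooth_wordDeriv hf p.1).continuous (isSmooth_wordDeriv hg p.2).continuous
        (hCg p.2 h2)
      have h' := integral_sq_wordDeriv_le_sobolevEnergy f (n := n) (v := p.1) (by omega)
      have hC2 : 0 ≤ C ^ 2 := sq_nonneg C
      calc _ ≤ C ^ 2 * ∫ x, wordDeriv p.1 f x ^ 2 := h
        _ ≤ C ^ 2 * (sobolevEnergy n f + sobolevEnergy n g) := by
            exact mul_le_mul_of_nonneg_left (by linarith) hC2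
  have hsum : ∑ k : Fin (splits w).length, ∫ x, (fun y => wordDeriv ((splits w).get k).1 f y *
      wordDeriv ((splits w).get k).2 g y) x ^ 2 ≤ (splits w).length * (C ^ 2 * (sobolevEnergy n f + sobolevEnergy n g)) := by
    have := Finset.sum_le_sum fun k (_ : k ∈ Finset.univ) => hterm k
    simpa using this
  have hlen : ((splits w).length : ℝ) = 2 ^ w.length := by rw [length_splits]; push_cast; ring
  have h4 : (4 : ℝ) ^ w.length = 2 ^ w.length * 2 ^ w.length := by rw [← mul_pow]; norm_num
  have hK : 0 ≤ C ^ 2 * (sobolevEnergy n f + sobolevEnergy n g) := by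
    have := sobolevEnergy_nonneg n f; have := sobolevEnergy_nonneg n g; positivity
  calc _ ≤ ((splits w).length : ℝ) * ((splits w).length * (C ^ 2 * (sobolevEnergy n f + sobolevEnergy n g))) :=
        mul_le_mul_of_nonneg_left hsum (Nat.cast_nonneg _)
    _ = 4 ^ w.length * (C ^ 2 * (sobolevEnergy n f + sobolevEnergy n g)) := by
        rw [hlen, h4]; ring

/-! ## The `L²` chain rule along words -/

/-- **`L²` chain rule along words, all orders**: for every `n` and `Cφ, Cρ` there is `K ≥ 0` with
`∫ (∂^w(φ ∘ ρ))² ≤ K · sobolevEnergy n ρ` for `1 ≤ |w| ≤ n`, for all smooth `φ` on an open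
`V ⊇ range ρ` with `|φ^{(k)}(ρ x)| ≤ Cφ` (`k ≤ n`) and all smooth `ρ` with `|∂^v ρ| ≤ Cρ` for
`1 ≤ |v|`, `2|v| ≤ n` (sup bounds up to HALF the order only). [cite: Majda1984, Ch. 2 §2.1 Prop. 2.1] -/
theorem exists_wordDeriv_comp_L2_bound (d : Type*) [Fintype d] [DecidableEq d] (n : ℕ) (Cφ Cρ : ℝ) :
    ∃ K : ℝ, 0 ≤ K ∧ ∀ (φ : ℝ → ℝ) (V : Set ℝ), IsOpen V → ContDiffOn ℝ ∞ φ V →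
      ∀ (ρ : UnitAddTorus d → ℝ), IsSmooth ρ → (∀ x, ρ x ∈ V) →
      (∀ k ≤ n, ∀ x, |(deriv^[k] φ) (ρ x)| ≤ Cφ) →
      (∀ v : List d, 1 ≤ v.length → 2 * v.length ≤ n → ∀ x, |wordDeriv v ρ x| ≤ Cρ) →
      ∀ w : List d, 1 ≤ w.length → w.length ≤ n →
        ∫ x, wordDeriv w (fun y => φ (ρ y)) x ^ 2 ≤ K * sobolevEnergy n ρ := by
  induction n with
  | zero => exact ⟨0, le_rfl, fun φ V _ _ ρ _ _ _ _ w h1 h0 => by omega⟩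
  | succ n ih =>
      obtain ⟨Kn, hKn0, hKn⟩ := ih
      -- sup constant for the composite factors `∂^α(φ' ∘ ρ)`, `2|α| ≤ n + 1`
      obtain ⟨Ks, hKs0, hKs⟩ := exists_wordDeriv_comp_bound d ((n + 1) / 2) Cφ Cρ
      set L : ℝ := max (|Cφ|) Ks with hL
      set K : ℝ := 2 ^ n * (2 ^ n * (L ^ 2 + Cρ ^ 2 * Kn)) with hKdef
      refine ⟨K, by positivity, ?_⟩
      intro φ V hV hφ ρ hρ hρV hCφ hCρ w hw1 hwn
      obtain ⟨w', i, rfl⟩ : ∃ w' i, w = w' ++ [i] := by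
        rcases List.eq_nil_or_concat w with h | ⟨M, b, h⟩
        · subst h; simp at hw1
        · exact ⟨M, b, by rw [h, List.concat_eq_append]⟩
      have hlen : w'.length ≤ n := by rw [List.length_append, List.length_singleton] at hwn; omega
      rw [wordDeriv_comp_concat hφ hV hρ hρV w' i]
      have hφ' : ContDiffOn ℝ ∞ (deriv φ) V := contDiffOn_deriv_of_isOpen hφ hV
      have sφ'ρ : IsSmooth (fun y => deriv φ (ρ y)) := IsSmooth.comp_of_contDiffOn hφ' hρ hρV
      have hcont : ∀ p ∈ splits w', Continuous (fun x => wordDeriv p.1 (fun y => deriv φ (ρ y)) x *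
          wordDeriv p.2 (Torus.partialDeriv i ρ) x) := fun p _ => by
        have hm : IsSmooth (fun x => wordDeriv p.1 (fun y => deriv φ (ρ y)) x * wordDeriv p.2 (Torus.partialDeriv i ρ) x) :=
          (isSmooth_wordDeriv sφ'ρ p.1).mul (isSmooth_wordDeriv (hρ.partialDeriv i) p.2)
        exact hm.continuous
      refine (integral_sq_list_sum_le (splits w') hcont).trans ?_
      -- bounds for `φ'`
      have hCφ' : ∀ k ≤ n, ∀ x, |(deriv^[k] (deriv φ)) (ρ x)| ≤ Cφ := fun k hk x => by
        have := hCφ (k + 1) (by omega) x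
        rwa [Function.iterate_succ_apply] at this
      have hCφ'' : ∀ k ≤ (n + 1) / 2, ∀ x, |(deriv^[k] (deriv φ)) (ρ x)| ≤ Cφ := fun k hk x =>
        hCφ' k (by omega) x
      have hE := sobolevEnergy_nonneg (n + 1) ρ
      -- each term
      have hterm : ∀ k : Fin (splits w').length,
          ∫ x, (fun x => wordDeriv ((splits w').get k).1 (fun y => deriv φ (ρ y)) x *
            wordDeriv ((splits w').get k).2 (Torus.partialDeriv i ρ) x) x ^ 2 ≤
            (L ^ 2 + Cρ ^ 2 * Kn) * sobolevEnergy (n + 1) ρ := by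
        intro k
        set p := (splits w').get k with hp
        have hpm : p ∈ splits w' := List.get_mem _ k
        have hl := mem_splits_length hpm
        -- the second factor is `∂^{β ++ [i]} ρ`
        have eβ : wordDeriv p.2 (Torus.partialDeriv i ρ) = wordDeriv (p.2 ++ [i]) ρ := (wordDeriv_concat p.2 i ρ).symm
        have hKn_le : Cρ ^ 2 * Kn * sobolevEnergy (n + 1) ρ ≤ (L ^ 2 + Cρ ^ 2 * Kn) * sobolevEnergy (n + 1) ρ := by
          have : 0 ≤ L ^ 2 * sobolevEnergy (n + 1) ρ := by positivity
          nlinarith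
        have hL_le : L ^ 2 * sobolevEnergy (n + 1) ρ ≤ (L ^ 2 + Cρ ^ 2 * Kn) * sobolevEnergy (n + 1) ρ := by
          have : 0 ≤ Cρ ^ 2 * Kn * sobolevEnergy (n + 1) ρ := by positivity
          nlinarith
        by_cases hc : 2 * p.1.length ≤ w'.length + 1
        · -- composite factor in sup
          have hsupA : ∀ x, |wordDeriv p.1 (fun y => deriv φ (ρ y)) x| ≤ L := by
            intro x
            by_cases h0 : p.1 = []
            · rw [h0, wordDeriv_nil]
              have := hCφ 1 (by omega) x
              simp only [Function.iterate_one] at this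
              exact (this.trans (le_abs_self _)).trans (le_max_left _ _)
            · have h1 : 1 ≤ p.1.length := List.length_pos_iff.2 h0
              refine (hKs (deriv φ) V hV hφ' ρ hρ hρV hCφ'' (fun v hv1 hv2 y => hCρ v hv1 (by omega) y) p.1 h1
                (by omega) x).trans (le_max_right _ _)
          have h := integral_sq_mul_le_sup_left (isSmooth_wordDeriv sφ'ρ p.1).continuous
            (isSmooth_wordDeriv (hρ.partialDeriv i) p.2).continuous hsupA
          rw [eβ] at h ⊢
          have h' := integral_sq_wordDeriv_le_sobolevEnergy ρ (n := n + 1) (v := p.2 ++ [i])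
            (by rw [List.length_append, List.length_singleton]; omega)
          calc _ ≤ L ^ 2 * ∫ x, wordDeriv (p.2 ++ [i]) ρ x ^ 2 := h
            _ ≤ L ^ 2 * sobolevEnergy (n + 1) ρ := mul_le_mul_of_nonneg_left h' (sq_nonneg _)
            _ ≤ _ := hL_le
        · -- `∂^{β ++ [i]} ρ` in sup, composite factor in `L²` by induction
          have hc' : w'.length + 1 < 2 * p.1.length := not_le.mp hc
          have h1 : 1 ≤ p.1.length := by omega
          have hsupB : ∀ x, |wordDeriv p.2 (Torus.partialDeriv i ρ) x| ≤ |Cρ| := fun x => by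
            rw [eβ]
            refine (hCρ (p.2 ++ [i]) (by simp) ?_ x).trans (le_abs_self _)
            rw [List.length_append, List.length_singleton]; omega
          have h := integral_sq_mul_le_sup_right (isSmooth_wordDeriv sφ'ρ p.1).continuous
            (isSmooth_wordDeriv (hρ.partialDeriv i) p.2).continuous hsupB
          have hIH := hKn (deriv φ) V hV hφ' ρ hρ hρV hCφ' (fun v hv1 hv2 y => hCρ v hv1 (by omega) y) p.1 h1
            (by omega)
          have hmono := sobolevEnergy_mono (Nat.le_succ n) ρ
          calc _ ≤ |Cρ| ^ 2 * ∫ x, wordDeriv p.1 (fun y => deriv φ (ρ y)) x ^ 2 := h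
            _ ≤ |Cρ| ^ 2 * (Kn * sobolevEnergy n ρ) := mul_le_mul_of_nonneg_left hIH (sq_nonneg _)
            _ ≤ Cρ ^ 2 * Kn * sobolevEnergy (n + 1) ρ := by
                rw [sq_abs, mul_assoc]
                exact mul_le_mul_of_nonneg_left (mul_le_mul_of_nonneg_left hmono hKn0) (sq_nonneg _)
            _ ≤ _ := hKn_le
      have hsum : ∑ k : Fin (splits w').length, ∫ x, (fun x => wordDeriv ((splits w').get k).1 (fun y => deriv φ (ρ y)) x *
          wordDeriv ((splits w').get k).2 (Torus.partialDeriv i ρ) x) x ^ 2 ≤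
          (splits w').length * ((L ^ 2 + Cρ ^ 2 * Kn) * sobolevEnergy (n + 1) ρ) := by
        have := Finset.sum_le_sum fun k (_ : k ∈ Finset.univ) => hterm k
        simpa using this
      have hlenR : ((splits w').length : ℝ) ≤ 2 ^ n := by
        rw [length_splits]; exact_mod_cast Nat.pow_le_pow_right (by norm_num) hlen
      have hM : 0 ≤ (L ^ 2 + Cρ ^ 2 * Kn) * sobolevEnergy (n + 1) ρ := by positivity
      calc _ ≤ ((splits w').length : ℝ) * (((splits w').length : ℝ) * ((L ^ 2 + Cρ ^ 2 * Kn) * sobolevEnergy (n + 1) ρ)) :=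
            mul_le_mul_of_nonneg_left hsum (Nat.cast_nonneg _)
        _ ≤ 2 ^ n * (2 ^ n * ((L ^ 2 + Cρ ^ 2 * Kn) * sobolevEnergy (n + 1) ρ)) := by
            have h2 : 0 ≤ ((splits w').length : ℝ) := Nat.cast_nonneg _
            exact mul_le_mul hlenR (mul_le_mul_of_nonneg_right hlenR hM) (mul_nonneg h2 hM) (by positivity)
        _ = K * sobolevEnergy (n + 1) ρ := by rw [hKdef]; ring

end Torus

end Literature.Analysis.FluidPDE

end
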